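import Mathlib
import Literature.Computability.Complexity.ExtMonotoneGates
import Literature.Computability.Complexity.ExtMonotoneGRankSupport
import Literature.Computability.Complexity.CliqueApproximatorsWide
import Literature.Computability.Complexity.RossmanMonotoneCliqueProb
import Summits.PneNP.PneNP.Theses.ConvexRankGates

/-!
# drefute gen 3 — level structure of the SG stubs (Lean, 0 sorry)

For the lead of line `dnf-invariant-wide-gates-see-small-cliques` (crux stmt-PneNP-10681), stubs
`stub_sgPerm` / `stub_sgGRank`. Definitions `atomB`, `IsTermGate`, `lostPos`, `gainedNeg`, `SGAt`, `kOf`,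
`lOf`, `qOf`, `epsOf`, `SGPerm`, `SGGRank` are VERBATIM copies of the skeleton's §1–§2/§4 (the Lines file is
not an importable module); inside the skeleton the theorems below paste next to `sg_of_locality` unchanged.

* `sgAt_anti` — `SGAt` is antitone in the gate class and in `ε` (bigger class / smaller `ε` is stronger).
* `epsOf_anti` — `epsOf c' m ≤ epsOf c m` for `c ≤ c'`, `1 ≤ m`.
* `sgPerm_iff_frequently`, `sgGRank_iff_frequently` — **violation is monotone in the level**: `SGPerm`
  (resp. `SGGRank`) already follows from SG at an UNBOUNDED set of levels `c`; equivalently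
  (`not_sgPerm_iff`, `not_sgGRank_iff`) a refutation is exactly ONE level `c₀` from which on EVERY level is
  violated for infinitely many `m`. So both research stubs are statements about `c → ∞` only
  (poly-parameter gates, inverse-polynomial one-sided error), as used informally by gen-0/gen-2.
* `isPermGate_one_const`, `sgAt_permGate_one`, `sgPerm_level_zero` — the level `c = 0` of `SGPerm` is
  TRUE outright (a PERM gate on `≤ 1` point is the constant `true`; witness `𝒜 = {∅}`, zero error both
  sides): the `∀ c` of the stub has content from `c = 1` on.
-/

set_option linter.dupNamespace false

namespace Summit.PneNP.PneNP.Cruxes.LinAlgGateBlind.DnfInvariantWideGatesSeeSmallCliques.DrefuteG3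

open Finset Filter Literature.Computability.Complexity Razborov

noncomputable section

/-! ### Verbatim copies of the skeleton's definitions (§1, §2, §4) -/

/-- (copy of the skeleton's `kOf`) -/
def kOf (m : ℕ) : ℕ := ⌈(m : ℝ) ^ (1 / 8 : ℝ)⌉₊

/-- (copy of the skeleton's `lOf`) -/
def lOf (m : ℕ) : ℕ := ⌊Real.sqrt ((kOf m : ℝ) / (4 * Real.logb 2 m + 1))⌋₊

/-- (copy of the skeleton's `qOf`) -/
def qOf (m : ℕ) : ℝ := 1 - 4 * Real.log m / (kOf m : ℝ)

/-- (copy of the skeleton's `epsOf`) -/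
def epsOf (c m : ℕ) : ℝ := (m : ℝ) ^ (-((c : ℝ) + 1)) / 4

/-- (copy of the skeleton's `epsOf_nonneg`) -/
theorem epsOf_nonneg (c m : ℕ) : 0 ≤ epsOf c m :=
  div_nonneg (Real.rpow_nonneg (Nat.cast_nonneg m) _) (by norm_num)

open Classical in
/-- (copy of the skeleton's `atomB`) -/
def atomB {m : ℕ} (X : Finset (Fin m)) (x : KEdge m → Bool) : Bool := decide (CliquePresent X x)

/-- (copy of the skeleton's `IsTermGate`) -/
def IsTermGate (m : ℕ) (P : GateFn → Prop) (l : ℕ) (O : (KEdge m → Bool) → Bool) : Prop :=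
  ∃ g : GateFn, P g ∧ ∃ X : Fin g.1 → Finset (Fin m),
    (∀ a, X a ∈ smallSets (Fin m) l) ∧ ∀ x, O x = g.2 (fun a => atomB (X a) x)

open Classical in
/-- (copy of the skeleton's `lostPos`) -/
def lostPos (m k : ℕ) (O : (KEdge m → Bool) → Bool) (𝒜 : Finset (Finset (Fin m))) :
    Finset (Finset (Fin m)) :=
  (powersetCard k (univ : Finset (Fin m))).filter fun S =>
    O (cliqueVec S) = true ∧ ¬ Accepts 𝒜 (cliqueVec S)

/-- (copy of the skeleton's `gainedNeg`) -/
def gainedNeg (m : ℕ) (q : ℝ) (O : (KEdge m → Bool) → Bool) (𝒜 : Finset (Finset (Fin m))) : ℝ :=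
  prob q (fun x : KEdge m → Bool => O x = false ∧ Accepts 𝒜 x)

/-- (copy of the skeleton's `SGAt`) -/
def SGAt (m : ℕ) (P : GateFn → Prop) (l k : ℕ) (q ε : ℝ) : Prop :=
  ∀ O : (KEdge m → Bool) → Bool, IsTermGate m P l O →
    ∃ 𝒜 ⊆ smallSets (Fin m) l,
      (#(lostPos m k O 𝒜) : ℝ) ≤ ε * (m.choose k : ℝ) ∧ gainedNeg m q O 𝒜 ≤ ε

/-- (copy of the skeleton's `SGPerm`) -/
def SGPerm : Prop :=
  ∀ c : ℕ, ∀ᶠ m : ℕ in atTop, SGAt m (IsPermGate (m ^ c)) (lOf m) (kOf m) (qOf m) (epsOf c m)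

/-- (copy of the skeleton's `SGGRank`) -/
def SGGRank : Prop :=
  ∀ c : ℕ, ∀ᶠ m : ℕ in atTop, SGAt m (IsGRankGate (m ^ c)) (lOf m) (kOf m) (qOf m) (epsOf c m)

/-! ### Monotonicity of `SGAt` in the class and the level -/

/-- Term gates over a smaller class are term gates over a bigger class. -/
theorem isTermGate_mono {m l : ℕ} {P P' : GateFn → Prop} (hPP' : ∀ g, P g → P' g)
    {O : (KEdge m → Bool) → Bool} (h : IsTermGate m P l O) : IsTermGate m P' l O := by
  obtain ⟨g, hg, X, hX, hO⟩ := h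
  exact ⟨g, hPP' g hg, X, hX, hO⟩

/-- **`SGAt` is antitone in the gate class and in `ε`.** -/
theorem sgAt_anti {m : ℕ} {P P' : GateFn → Prop} {l k : ℕ} {q ε ε' : ℝ}
    (hPP' : ∀ g, P g → P' g) (hε : ε' ≤ ε) (h : SGAt m P' l k q ε') : SGAt m P l k q ε := by
  intro O hO
  obtain ⟨𝒜, h𝒜, hlost, hgain⟩ := h O (isTermGate_mono hPP' hO)
  exact ⟨𝒜, h𝒜, hlost.trans (mul_le_mul_of_nonneg_right hε (Nat.cast_nonneg _)), hgain.trans hε⟩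

/-- The budget shrinks with the level: `epsOf c' m ≤ epsOf c m` for `c ≤ c'` (`m ≥ 1`). -/
theorem epsOf_anti {c c' : ℕ} (hcc' : c ≤ c') {m : ℕ} (hm : 1 ≤ m) : epsOf c' m ≤ epsOf c m := by
  unfold epsOf
  have hm' : (1 : ℝ) ≤ m := by exact_mod_cast hm
  have hc : (c : ℝ) ≤ c' := by exact_mod_cast hcc'
  have h := Real.rpow_le_rpow_of_exponent_le hm' (show -((c' : ℝ) + 1) ≤ -((c : ℝ) + 1) by linarith)
  linarith

/-- **Violation is monotone in the level (PERM).** `SGPerm` follows from SG at an unbounded set of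
levels: for `c ≤ c'` and `m ≥ 1`, `PERM_{m^c} ⊆ PERM_{m^{c'}}` and `epsOf c' m ≤ epsOf c m`. -/
theorem sgPerm_iff_frequently :
    SGPerm ↔ ∀ c₀ : ℕ, ∃ c, c₀ ≤ c ∧ ∀ᶠ m : ℕ in atTop,
      SGAt m (IsPermGate (m ^ c)) (lOf m) (kOf m) (qOf m) (epsOf c m) := by
  constructor
  · exact fun h c₀ => ⟨c₀, le_rfl, h c₀⟩
  · intro h c₀
    obtain ⟨c, hc, hev⟩ := h c₀
    filter_upwards [hev, eventually_ge_atTop 1] with m hm h1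
    exact sgAt_anti (fun g hg => hg.mono (Nat.pow_le_pow_right h1 hc)) (epsOf_anti hc h1) hm

/-- **Violation is monotone in the level (GRANK).** -/
theorem sgGRank_iff_frequently :
    SGGRank ↔ ∀ c₀ : ℕ, ∃ c, c₀ ≤ c ∧ ∀ᶠ m : ℕ in atTop,
      SGAt m (IsGRankGate (m ^ c)) (lOf m) (kOf m) (qOf m) (epsOf c m) := by
  constructor
  · exact fun h c₀ => ⟨c₀, le_rfl, h c₀⟩
  · intro h c₀
    obtain ⟨c, hc, hev⟩ := h c₀
    filter_upwards [hev, eventually_ge_atTop 1] with m hm h1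
    exact sgAt_anti (fun g hg => hg.mono (Nat.pow_le_pow_right h1 hc)) (epsOf_anti hc h1) hm

/-- **Shape of a refutation of `stub_sgPerm`.** `¬ SGPerm` iff from some level `c₀` on, EVERY level `c`
is violated for infinitely many `m`. -/
theorem not_sgPerm_iff :
    ¬ SGPerm ↔ ∃ c₀ : ℕ, ∀ c, c₀ ≤ c → ∃ᶠ m : ℕ in atTop,
      ¬ SGAt m (IsPermGate (m ^ c)) (lOf m) (kOf m) (qOf m) (epsOf c m) := by
  rw [sgPerm_iff_frequently]
  simp only [not_forall, not_exists, not_and, Filter.not_eventually]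

/-- **Shape of a refutation of `stub_sgGRank`.** -/
theorem not_sgGRank_iff :
    ¬ SGGRank ↔ ∃ c₀ : ℕ, ∀ c, c₀ ≤ c → ∃ᶠ m : ℕ in atTop,
      ¬ SGAt m (IsGRankGate (m ^ c)) (lOf m) (kOf m) (qOf m) (epsOf c m) := by
  rw [sgGRank_iff_frequently]
  simp only [not_forall, not_exists, not_and, Filter.not_eventually]

/-! ### Level zero of `SGPerm` is true -/

/-- A PERM gate on at most one point computes the constant `true` (`Sym(Fin d)` is trivial for
`d ≤ 1`, so `τ = 1` lies in every subgroup). -/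
theorem isPermGate_one_const {g : GateFn} (hg : IsPermGate 1 g) : ∀ v, g.2 v = true := by
  obtain ⟨d, hd, σ, τ, h⟩ := hg
  intro v
  rw [h v]
  have hsub : Subsingleton (Fin d) := by
    rcases Nat.le_one_iff_eq_zero_or_eq_one.1 hd with rfl | rfl <;> infer_instance
  have : Subsingleton (Equiv.Perm (Fin d)) := inferInstance
  rw [Subsingleton.elim τ 1]
  exact Subgroup.one_mem _

/-- **SG at level zero, PERM.** Every `PERM_1` term gate is the constant `true`; `𝒜 = {∅}` approximates it
with no lost clique and no gained mass (needs only `0 ≤ ε`). -/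
theorem sgAt_permGate_one (m l k : ℕ) (q : ℝ) {ε : ℝ} (hε : 0 ≤ ε) :
    SGAt m (IsPermGate 1) l k q ε := by
  classical
  intro O hO
  obtain ⟨g, hg, X, -, hOg⟩ := hO
  have hO1 : ∀ x, O x = true := fun x => by rw [hOg x]; exact isPermGate_one_const hg _
  refine ⟨{∅}, fun W hW => ?_, ?_, ?_⟩
  · rw [mem_singleton] at hW
    subst hW
    exact empty_mem_smallSets l
  · have h0 : lostPos m k O {∅} = ∅ := by
      refine filter_eq_empty_iff.2 fun S _ h => ?_
      exact h.2 ⟨∅, mem_singleton_self _, cliquePresent_empty _⟩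
    rw [h0, card_empty, Nat.cast_zero]
    exact mul_nonneg hε (Nat.cast_nonneg _)
  · have hempty : prob q (fun x : KEdge m → Bool => O x = false ∧ Accepts {∅} x) =
        prob q (fun _ : KEdge m → Bool => False) :=
      prob_congr fun x => ⟨fun h => by simp [hO1 x] at h, fun h => h.elim⟩
    unfold gainedNeg
    rw [hempty, prob_false]
    exact hε

/-- **`SGPerm` at `c = 0` holds for every `m`** (`m ^ 0 = 1`). -/
theorem sgPerm_level_zero :
    ∀ m : ℕ, SGAt m (IsPermGate (m ^ 0)) (lOf m) (kOf m) (qOf m) (epsOf 0 m) := fun m => by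
  rw [pow_zero]
  exact sgAt_permGate_one _ _ _ _ (epsOf_nonneg 0 m)


/-! ### Level zero of `SGGRank` is true -/

/-- Entries of the generic symbolic matrix `K₀ + ∑ Xᵢ Kᵢ` are affine-linear: every monomial in the support
of an entry is `1` or a single variable `Xᵢ`. -/
theorem mem_support_symbolicPolyMatrix {F : Type*} [Field F] {n d : ℕ}
    (K₀ : Matrix (Fin d) (Fin d) F) (K : Fin n → Matrix (Fin d) (Fin d) F) (a b : Fin d)
    {s : Fin n →₀ ℕ} (hs : s ∈ (symbolicPolyMatrix K₀ K a b).support) :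
    s = 0 ∨ ∃ i, s = Finsupp.single i 1 := by
  classical
  have h1 : symbolicPolyMatrix K₀ K a b =
      MvPolynomial.C (K₀ a b) + ∑ i, MvPolynomial.X i * MvPolynomial.C (K i a b) := by
    simp only [symbolicPolyMatrix, Matrix.add_apply, Matrix.sum_apply, Matrix.smul_apply,
      Matrix.map_apply, smul_eq_mul]
  rw [h1] at hs
  rcases Finset.mem_union.1 (MvPolynomial.support_add hs) with h | h
  · left
    rw [MvPolynomial.C_apply] at h
    exact Finset.mem_singleton.1 (MvPolynomial.support_monomial_subset h)
  · right
    obtain ⟨i, -, hi⟩ := Finset.mem_biUnion.1 (MvPolynomial.support_sum h)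
    refine ⟨i, ?_⟩
    have h2 : (MvPolynomial.X i * MvPolynomial.C (K i a b) : MvPolynomial (Fin n) F) =
        MvPolynomial.monomial (Finsupp.single i 1) (K i a b) := by
      rw [show (MvPolynomial.X i : MvPolynomial (Fin n) F) = MvPolynomial.monomial (Finsupp.single i 1) 1
        from rfl, MvPolynomial.C_apply, MvPolynomial.monomial_mul, add_zero, one_mul]
    rw [h2] at hi
    exact Finset.mem_singleton.1 (MvPolynomial.support_monomial_subset hi)

/-- **Minterms of a `GRANK_1` gate have width `≤ 1`.** If a generic-rank gate of dimension `≤ 1` accepts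
`v`, some set `t` of at most one switched-on input already forces acceptance (the `θ`-minors of a
`≤ 1`-dimensional affine pencil are `1`, an affine-linear entry, or `0`). -/
theorem isGRankGate_one_width {g : GateFn} (hg : IsGRankGate 1 g) (v : Fin g.1 → Bool)
    (hv : g.2 v = true) :
    ∃ t : Finset (Fin g.1), #t ≤ 1 ∧ (∀ i ∈ t, v i = true) ∧
      ∀ w : Fin g.1 → Bool, (∀ i ∈ t, w i = true) → g.2 w = true := by
  classical
  obtain ⟨F, _, d, θ, hd, K₀, K, hg⟩ := hg
  rw [hg v, le_rank_symbolicMatrix_iff] at hv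
  obtain ⟨r, c, s, hs, hsv⟩ := hv
  have hsub : Subsingleton (Fin d) := by
    rcases Nat.le_one_iff_eq_zero_or_eq_one.1 hd with rfl | rfl <;> infer_instance
  -- the monomial `s` is `1` or a single variable
  have hs' : s = 0 ∨ ∃ i, s = Finsupp.single i 1 := by
    rcases Nat.lt_or_ge θ 2 with hθ | hθ
    · interval_cases θ
      · -- `θ = 0`: the empty minor is `1`
        rw [Matrix.det_isEmpty, MvPolynomial.one_def] at hs
        exact Or.inl (Finset.mem_singleton.1 (MvPolynomial.support_monomial_subset hs))
      · -- `θ = 1`: the minor is an entry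
        rw [Matrix.det_fin_one, Matrix.submatrix_apply] at hs
        exact mem_support_symbolicPolyMatrix K₀ K _ _ hs
    · -- `θ ≥ 2`: two equal rows, the minor vanishes
      exfalso
      have h0 : ((symbolicPolyMatrix K₀ K).submatrix r c).det = 0 := by
        refine Matrix.det_zero_of_row_eq (i := ⟨0, by omega⟩) (j := ⟨1, by omega⟩)
          (fun h => absurd (congrArg Fin.val h) (by simp)) ?_
        ext j
        simp only [Matrix.submatrix_apply, Subsingleton.elim (r ⟨0, by omega⟩) (r ⟨1, by omega⟩)]
      rw [h0, MvPolynomial.support_zero] at hs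
      exact absurd hs (Finset.notMem_empty _)
  refine ⟨s.support, ?_, hsv, fun w hw => ?_⟩
  · rcases hs' with rfl | ⟨i, rfl⟩
    · simp
    · simp
  · rw [hg w, le_rank_symbolicMatrix_iff]
    exact ⟨r, c, s, hs, hw⟩

/-- **SG at level zero, GRANK.** A `GRANK_1` term gate is a constant or an OR of some of its atoms (plus
possibly the constant `true`), so the family of those atoms `X_a` (and `∅`) whose presence forces
acceptance approximates it with no lost clique and no gained mass (needs only `0 ≤ ε`). -/
theorem sgAt_gRankGate_one (m l k : ℕ) (q : ℝ) {ε : ℝ} (hε : 0 ≤ ε) :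
    SGAt m (IsGRankGate 1) l k q ε := by
  classical
  intro O hO
  obtain ⟨g, hg, X, hX, hOg⟩ := hO
  -- the forcing atoms
  let 𝒜 : Finset (Finset (Fin m)) :=
    (insert ∅ (univ.image X)).filter fun W => ∀ x : KEdge m → Bool, CliquePresent W x → O x = true
  have h𝒜O : ∀ x, Accepts 𝒜 x → O x = true := by
    rintro x ⟨W, hW, hWx⟩
    exact (mem_filter.1 hW).2 x hWx
  refine ⟨𝒜, fun W hW => ?_, ?_, ?_⟩
  · -- `𝒜 ⊆ 𝒱(l)`
    rcases mem_insert.1 (mem_filter.1 hW).1 with rfl | hW'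
    · exact empty_mem_smallSets l
    · obtain ⟨a, -, rfl⟩ := mem_image.1 hW'
      exact hX a
  · -- no lost clique
    have h0 : lostPos m k O 𝒜 = ∅ := by
      refine filter_eq_empty_iff.2 fun S _ h => h.2 ?_
      have hv : g.2 (fun a => atomB (X a) (cliqueVec S)) = true := by rw [← hOg]; exact h.1
      obtain ⟨t, ht, htv, hforce⟩ := isGRankGate_one_width hg _ hv
      rcases t.eq_empty_or_nonempty with rfl | ⟨i, hi⟩
      · -- constant-true gate: `∅` forces
        refine ⟨∅, mem_filter.2 ⟨mem_insert_self _ _, fun x _ => ?_⟩, cliquePresent_empty _⟩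
        rw [hOg x]
        exact hforce _ (by simp)
      · -- the atom `X i` forces
        have hti : ∀ j ∈ t, j = i := fun j hj => Finset.card_le_one.1 ht j hj i hi
        refine ⟨X i, mem_filter.2 ⟨mem_insert_of_mem (mem_image_of_mem X (mem_univ i)),
          fun x hx => ?_⟩, ?_⟩
        · rw [hOg x]
          refine hforce _ fun j hj => ?_
          rw [hti j hj]
          unfold atomB
          exact decide_eq_true hx
        · have := htv i hi
          unfold atomB at this
          exact of_decide_eq_true this
    rw [h0, card_empty, Nat.cast_zero]
    exact mul_nonneg hε (Nat.cast_nonneg _)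
  · -- no gained mass
    have hempty : prob q (fun x : KEdge m → Bool => O x = false ∧ Accepts 𝒜 x) =
        prob q (fun _ : KEdge m → Bool => False) :=
      prob_congr fun x => ⟨fun h => by have := h𝒜O x h.2; rw [h.1] at this; exact Bool.false_ne_true this,
        fun h => h.elim⟩
    unfold gainedNeg
    rw [hempty, prob_false]
    exact hε

/-- **`SGGRank` at `c = 0` holds for every `m`** (`m ^ 0 = 1`). -/
theorem sgGRank_level_zero :
    ∀ m : ℕ, SGAt m (IsGRankGate (m ^ 0)) (lOf m) (kOf m) (qOf m) (epsOf 0 m) := fun m => by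
  rw [pow_zero]
  exact sgAt_gRankGate_one _ _ _ _ (epsOf_nonneg 0 m)

end

end Summit.PneNP.PneNP.Cruxes.LinAlgGateBlind.DnfInvariantWideGatesSeeSmallCliques.DrefuteG3
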